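import Mathlib
import Summits.Ventures.PercRepro2.HCov
import Summits.Ventures.PercRepro2.HCovSwap
import Summits.Ventures.PercRepro2.PendantRoot
import Summits.Ventures.PercRepro2.J1CoincTable
import Summits.Ventures.PercRepro2.J1Coinc
import Summits.Ventures.PercRepro2.J1PendantB

/-!
# (J1) holds at every pendant `b` attached to `o` or to `a₃`
(blind cell PercRepro2, mine-a g10 — MINE-A.md §53.9)

`J1Pendant.J1_pendant_b` reduces the cleared cross term at a pendant `b` (edge `f` to `y`) to `p f` times
the cleared cross term at `y`; at `y = o` resp. `y = a₃` the latter collapses to the 9-cell forms of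
`J1Coinc.J1_coinc_o` resp. `J1_coinc_a3` (`inter_self_right`, `inter_both_empty`: the doubled connection events
`{a₁ ↔ o} ∩ {a₁ ↔ o}` absorb and the mixed ones `{a₁ ↔ o} ∩ {a₂ ↔ o}` vanish under `Q`).  Hence
**`J1_pendant_at_o`**, **`J1_pendant_at_a3`**: `0 ≤ J1c(b)` whenever `b` is a leaf at `o` / at `a₃`
(the cleared `Cov_μ(σ_b, H)`, `H = σ₃ (γ − 1[o ∈ U, o ↮ a₃])`, `γ = P(o ∈ U | a₃ ∉ U, Q)`).  With
`J1_root_zero` (`y` a root) the cross term (J1) is settled at every pendant `b` attached to a mark.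
-/

namespace Summit.Ventures.PercRepro2

open UnionCluster PendantRoot

namespace J1Pendant

section Marked

variable {V : Type*} {E : Type*} [Fintype E] [DecidableEq E] [Fintype V] [DecidableEq V]
  {R : Type*} [Field R] [LinearOrder R] [IsStrictOrderedRing R]

variable (p : E → R) (ends : E → Sym2 V) (o a₁ a₂ a₃ : V)

local notation3 "Q" => avoidAll ends a₂ {a₁}
local notation3 "oL" => connEvent ends a₁ o
local notation3 "oH" => connEvent ends a₂ o
local notation3 "oN" => (connEvent ends a₁ o)ᶜ ∩ (connEvent ends a₂ o)ᶜ
local notation3 "tL" => connEvent ends a₁ a₃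
local notation3 "tH" => connEvent ends a₂ a₃
local notation3 "tN" => (connEvent ends a₁ a₃)ᶜ ∩ (connEvent ends a₂ a₃)ᶜ

omit [Fintype E] [DecidableEq E] [Fintype V] [DecidableEq V] in
/-- `A ∩ X ∩ X = A ∩ X`. -/
lemma inter_self_right (A X : Set (Config E)) : A ∩ X ∩ X = A ∩ X := by
  ext ω; simp only [Set.mem_inter_iff]; tauto

omit [Fintype E] [DecidableEq E] [Fintype V] [DecidableEq V] in
/-- Under `Q` a vertex is not in both clusters: `Q ∩ X ∩ {a₁ ↔ v} ∩ {a₂ ↔ v} = ∅`. -/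
lemma inter_both_empty (X : Set (Config E)) (v : V) :
    Q ∩ X ∩ connEvent ends a₁ v ∩ connEvent ends a₂ v = ∅ := by
  ext ω
  simp only [Set.mem_inter_iff, mem_connEvent, Set.mem_empty_iff_false, iff_false, not_and]
  exact fun h h2 => J1Coinc.not_both ends a₁ a₂ h.1.1 h.2 h2

omit [Fintype E] [DecidableEq E] [Fintype V] [DecidableEq V] in
/-- The mirror: `Q ∩ X ∩ {a₂ ↔ v} ∩ {a₁ ↔ v} = ∅`. -/
lemma inter_both_empty' (X : Set (Config E)) (v : V) :
    Q ∩ X ∩ connEvent ends a₂ v ∩ connEvent ends a₁ v = ∅ := by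
  ext ω
  simp only [Set.mem_inter_iff, mem_connEvent, Set.mem_empty_iff_false, iff_false, not_and]
  exact fun h h1 => J1Coinc.not_both ends a₁ a₂ h.1.1 h1 h.2

omit [Fintype E] [DecidableEq E] [Fintype V] [DecidableEq V] in
/-- `Q ∩ tL ∩ oL = Q ∩ oL ∩ tL` (the cell spelling). -/
lemma swap_tL_oL : Q ∩ tL ∩ oL = Q ∩ oL ∩ tL := Set.inter_right_comm _ _ _

omit [Fintype E] [DecidableEq E] [Fintype V] [DecidableEq V] in
/-- `Q ∩ tL ∩ oH = Q ∩ oH ∩ tL`. -/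
lemma swap_tL_oH : Q ∩ tL ∩ oH = Q ∩ oH ∩ tL := Set.inter_right_comm _ _ _

omit [Fintype E] [DecidableEq E] [Fintype V] [DecidableEq V] in
/-- `Q ∩ tH ∩ oL = Q ∩ oL ∩ tH`. -/
lemma swap_tH_oL : Q ∩ tH ∩ oL = Q ∩ oL ∩ tH := Set.inter_right_comm _ _ _

omit [Fintype E] [DecidableEq E] [Fintype V] [DecidableEq V] in
/-- `Q ∩ tH ∩ oH = Q ∩ oH ∩ tH`. -/
lemma swap_tH_oH : Q ∩ tH ∩ oH = Q ∩ oH ∩ tH := Set.inter_right_comm _ _ _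

omit [Fintype E] [DecidableEq E] [Fintype V] [DecidableEq V] in
/-- `Q ∩ tN ∩ oL = Q ∩ oL ∩ tN`. -/
lemma swap_tN_oL : Q ∩ tN ∩ oL = Q ∩ oL ∩ tN := Set.inter_right_comm _ _ _

omit [Fintype E] [DecidableEq E] [Fintype V] [DecidableEq V] in
/-- `Q ∩ tN ∩ oH = Q ∩ oH ∩ tN`. -/
lemma swap_tN_oH : Q ∩ tN ∩ oH = Q ∩ oH ∩ tN := Set.inter_right_comm _ _ _

/-- **(J1) at every pendant `b` attached to `o`**: `0 ≤ J1c(b)` (the cleared cross term of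
`J1Pendant.J1_pendant_b`), for `b` a leaf at `o` with `b ∉ {o, a₁, a₂, a₃}`. -/
theorem J1_pendant_at_o (hp : IsProbVec p) {f : E} {b : V} (hf : ends f = s(b, o))
    (hleaf : ∀ e, b ∈ ends e → e = f) (hbo : b ≠ o) (hb1 : b ≠ a₁) (hb2 : b ≠ a₂) (hb3 : b ≠ a₃) :
    0 ≤ prob p Q *
        ((prob p (Q ∩ tN ∩ oL) + prob p (Q ∩ tN ∩ oH)) *
            (prob p (Q ∩ tL ∩ connEvent ends a₁ b) - prob p (Q ∩ tL ∩ connEvent ends a₂ b)) -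
          prob p (Q ∩ tN) *
            (prob p (Q ∩ tL ∩ oH ∩ connEvent ends a₁ b) - prob p (Q ∩ tL ∩ oH ∩ connEvent ends a₂ b)) -
          (prob p (Q ∩ tN ∩ oL) + prob p (Q ∩ tN ∩ oH)) *
            (prob p (Q ∩ tH ∩ connEvent ends a₁ b) - prob p (Q ∩ tH ∩ connEvent ends a₂ b)) +
          prob p (Q ∩ tN) *
            (prob p (Q ∩ tH ∩ oL ∩ connEvent ends a₁ b) - prob p (Q ∩ tH ∩ oL ∩ connEvent ends a₂ b))) -
      (prob p (Q ∩ connEvent ends a₁ b) - prob p (Q ∩ connEvent ends a₂ b)) *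
        ((prob p (Q ∩ tN ∩ oL) + prob p (Q ∩ tN ∩ oH)) * (prob p (Q ∩ tL) - prob p (Q ∩ tH)) -
          prob p (Q ∩ tN) * (prob p (Q ∩ tL ∩ oH) - prob p (Q ∩ tH ∩ oL))) := by
  rw [J1_pendant_b p ends o a₁ a₂ a₃ hf hleaf hbo hbo hb1 hb2 hb3]
  refine mul_nonneg (hp.1 f) ?_
  -- collapse the `y = o` instance onto the nine cells
  simp only [inter_self_right, inter_both_empty, inter_both_empty', prob_empty]
  rw [swap_tL_oL ends o a₁ a₂ a₃, swap_tL_oH ends o a₁ a₂ a₃, swap_tH_oL ends o a₁ a₂ a₃,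
    swap_tH_oH ends o a₁ a₂ a₃, swap_tN_oL ends o a₁ a₂ a₃, swap_tN_oH ends o a₁ a₂ a₃]
  rw [J1Coinc.splitO p ends o a₁ a₂ tN, J1Coinc.splitO p ends o a₁ a₂ tL,
    J1Coinc.splitO p ends o a₁ a₂ tH, J1Coinc.split3 p ends a₁ a₂ a₃ oL,
    J1Coinc.split3 p ends a₁ a₂ a₃ oH]
  have h := J1Coinc.J1_coinc_o p ends o a₁ a₂ a₃ hp
  rw [J1Coinc.hZ p ends o a₁ a₂ a₃] at h ⊢
  linarith [h]

/-- **(J1) at every pendant `b` attached to `a₃`**: `0 ≤ J1c(b)` for `b` a leaf at `a₃` with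
`b ∉ {o, a₁, a₂, a₃}`. -/
theorem J1_pendant_at_a3 (hp : IsProbVec p) {f : E} {b : V} (hf : ends f = s(b, a₃))
    (hleaf : ∀ e, b ∈ ends e → e = f) (hbo : b ≠ o) (hb1 : b ≠ a₁) (hb2 : b ≠ a₂) (hb3 : b ≠ a₃) :
    0 ≤ prob p Q *
        ((prob p (Q ∩ tN ∩ oL) + prob p (Q ∩ tN ∩ oH)) *
            (prob p (Q ∩ tL ∩ connEvent ends a₁ b) - prob p (Q ∩ tL ∩ connEvent ends a₂ b)) -
          prob p (Q ∩ tN) *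
            (prob p (Q ∩ tL ∩ oH ∩ connEvent ends a₁ b) - prob p (Q ∩ tL ∩ oH ∩ connEvent ends a₂ b)) -
          (prob p (Q ∩ tN ∩ oL) + prob p (Q ∩ tN ∩ oH)) *
            (prob p (Q ∩ tH ∩ connEvent ends a₁ b) - prob p (Q ∩ tH ∩ connEvent ends a₂ b)) +
          prob p (Q ∩ tN) *
            (prob p (Q ∩ tH ∩ oL ∩ connEvent ends a₁ b) - prob p (Q ∩ tH ∩ oL ∩ connEvent ends a₂ b))) -
      (prob p (Q ∩ connEvent ends a₁ b) - prob p (Q ∩ connEvent ends a₂ b)) *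
        ((prob p (Q ∩ tN ∩ oL) + prob p (Q ∩ tN ∩ oH)) * (prob p (Q ∩ tL) - prob p (Q ∩ tH)) -
          prob p (Q ∩ tN) * (prob p (Q ∩ tL ∩ oH) - prob p (Q ∩ tH ∩ oL))) := by
  rw [J1_pendant_b p ends o a₁ a₂ a₃ hf hleaf hb3 hbo hb1 hb2 hb3]
  refine mul_nonneg (hp.1 f) ?_
  -- collapse the `y = a₃` instance onto the nine cells
  have e1 : Q ∩ tL ∩ tL = Q ∩ tL := inter_self_right _ _
  have e2 : Q ∩ tL ∩ tH = ∅ := by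
    have := inter_both_empty ends a₁ a₂ Set.univ a₃; rwa [Set.inter_univ] at this
  have e3 : Q ∩ tL ∩ oH ∩ tL = Q ∩ tL ∩ oH := by
    ext ω; simp only [Set.mem_inter_iff]; tauto
  have e4 : Q ∩ tL ∩ oH ∩ tH = ∅ := by
    ext ω
    simp only [Set.mem_inter_iff, mem_connEvent, Set.mem_empty_iff_false, iff_false, not_and]
    exact fun h htH => J1Coinc.not_both ends a₁ a₂ h.1.1 h.1.2 htH
  have e5 : Q ∩ tH ∩ tL = ∅ := by
    have := inter_both_empty' ends a₁ a₂ Set.univ a₃; rwa [Set.inter_univ] at this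
  have e6 : Q ∩ tH ∩ tH = Q ∩ tH := inter_self_right _ _
  have e7 : Q ∩ tH ∩ oL ∩ tL = ∅ := by
    ext ω
    simp only [Set.mem_inter_iff, mem_connEvent, Set.mem_empty_iff_false, iff_false, not_and]
    exact fun h htL => J1Coinc.not_both ends a₁ a₂ h.1.1 htL h.1.2
  have e8 : Q ∩ tH ∩ oL ∩ tH = Q ∩ tH ∩ oL := by
    ext ω; simp only [Set.mem_inter_iff]; tauto
  rw [e1, e2, e3, e4, e5, e6, e7, e8, prob_empty]
  rw [swap_tL_oH ends o a₁ a₂ a₃, swap_tH_oL ends o a₁ a₂ a₃, swap_tN_oL ends o a₁ a₂ a₃,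
    swap_tN_oH ends o a₁ a₂ a₃]
  rw [J1Coinc.splitO p ends o a₁ a₂ tN, J1Coinc.splitO p ends o a₁ a₂ tL,
    J1Coinc.splitO p ends o a₁ a₂ tH]
  have h := J1Coinc.J1_coinc_a3 p ends o a₁ a₂ a₃ hp
  rw [J1Coinc.hZ p ends o a₁ a₂ a₃] at h ⊢
  linarith [h]

end Marked

end J1Pendant

end Summit.Ventures.PercRepro2
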